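import Mathlib.LinearAlgebra.Matrix.Notation
import Mathlib.LinearAlgebra.Matrix.NonsingularInverse
import Mathlib.LinearAlgebra.Matrix.ToLinearEquiv
import Mathlib.LinearAlgebra.Matrix.Charpoly.Coeff
import Mathlib.LinearAlgebra.Matrix.Block
import Mathlib.FieldTheory.IsAlgClosed.Basic
import HarnessLib

/-!
# Simultaneous triangularisation of a `3 × 3` matrix pencil by equivalence

Topic `Literature/Computability/AlgebraicComplexity` (pencils = 2-slice tensors, Bürgisser–Clausen–
Shokrollahi 1997, Ch. 19). Over an algebraically closed field `F`, for every pair of matrices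
`M₁, M₂ ∈ F^{3×3}` there are matrices `P, Q` (invertible, though only the factorisation is recorded)
and UPPER TRIANGULAR `T₁, T₂` with `M₁ = P T₁ Q`, `M₂ = P T₂ Q`
(`MatrixPencil.exists_blockTriangular_factor`). This is the elementary first half of the
Weierstraß–Kronecker theory (BCS Thm. (19.3); Gantmacher, *Theory of Matrices* II, Ch. XII): a pencil
`s M₁ + t M₂` over an algebraically closed field has a singular member (`det` is a binary cubic form),
a kernel vector `w` of it spans a line mapped by both `M₁, M₂` into a common line `F u`; extending
`w` and `u` to bases clears the first column, and one repeats on the `2 × 2` block.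

It is used in `PencilBorderRankThree.lean` (every `3 × 3 × 2` tensor is a degeneration of `⟨3⟩`)
and through it in the proof of Alman–Li 2026, Prop. 4.3 (`AlmanLi2026ThreeByThreeProofs.lean`).

## Contents

* upper triangularity is Mathlib's `Matrix.BlockTriangular · id`; `MatrixPencil.blockTriangular_iff₃`
  unfolds it on `Fin 3` to the vanishing of the three entries below the diagonal.
* `MatrixPencil.exists_det_smul_add_smul_eq_zero` — a pencil of square matrices over an
  algebraically closed field has a singular member `s M₁ + t M₂`, `(s,t) ≠ 0` (via a root of a
  characteristic polynomial).
* `MatrixPencil.exists_isUnit_det_col_zero₃/₂` — a nonzero vector is the first column of an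
  invertible matrix.
* `MatrixPencil.exists_conj_col_zero₃/₂` — one triangularisation step.
* `MatrixPencil.exists_blockTriangular_factor` — the factorisation `M_k = P T_k Q` (the lift `1 ⊕ U` of
  the `2 × 2` step is a local matrix inside the proof).

Everything here is proved (theorems only; no definitions, no named facts).

## References

* P. Bürgisser, M. Clausen, M. A. Shokrollahi, *Algebraic Complexity Theory*, Springer 1997, §19.1,
  Thm. (19.3) (Weierstraß–Kronecker canonical form of pencils). [BurgisserClausenShokrollahi1997]
-/

noncomputable section

open scoped BigOperators Polynomial
open Matrix Polynomial

namespace Literature.Computability.AlgebraicComplexity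

namespace MatrixPencil

variable {F : Type*} [Field F]

/-- On `Fin 3`, Mathlib's upper triangularity `A.BlockTriangular id` says exactly that the three
entries below the diagonal vanish. [folklore] -/
theorem blockTriangular_iff₃ {R : Type*} [Zero R] (A : Matrix (Fin 3) (Fin 3) R) :
    A.BlockTriangular id ↔ A 1 0 = 0 ∧ A 2 0 = 0 ∧ A 2 1 = 0 := by
  refine ⟨fun h => ⟨h (by decide), h (by decide), h (by decide)⟩, fun h i j hij => ?_⟩
  obtain ⟨h10, h20, h21⟩ := h
  fin_cases i <;> fin_cases j <;> first | exact absurd hij (by decide) | assumption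

/-- Over an algebraically closed field every pencil of square matrices (of positive size) has a
singular member `s M₁ + t M₂` with `(s, t) ≠ 0`: if `M₁` is invertible take a root `s₀` of the
characteristic polynomial of `-M₁⁻¹M₂`, so that `det (s₀ M₁ + M₂) = det M₁ · χ(s₀) = 0`
(BCS §19.1: `det 𝔄` of a pencil is a binary form of degree `n`). [folklore] -/
theorem exists_det_smul_add_smul_eq_zero [IsAlgClosed F] {n : Type*} [Fintype n] [DecidableEq n]
    [Nonempty n] (M₁ M₂ : Matrix n n F) :
    ∃ s t : F, (s ≠ 0 ∨ t ≠ 0) ∧ (s • M₁ + t • M₂).det = 0 := by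
  by_cases h₁ : M₁.det = 0
  · exact ⟨1, 0, Or.inl one_ne_zero, by simpa using h₁⟩
  · have hu : IsUnit M₁.det := Ne.isUnit h₁
    set K : Matrix n n F := M₁⁻¹ * M₂ with hK
    obtain ⟨s₀, hs₀⟩ := IsAlgClosed.exists_root (-K).charpoly (by
      rw [Matrix.charpoly_degree_eq_dim]
      exact_mod_cast Fintype.card_ne_zero)
    refine ⟨s₀, 1, Or.inr one_ne_zero, ?_⟩
    have e : s₀ • M₁ + (1 : F) • M₂ = M₁ * (Matrix.scalar n s₀ - (-K)) := by
      rw [sub_neg_eq_add, Matrix.mul_add, Matrix.scalar_apply, ← smul_one_eq_diagonal,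
        Matrix.mul_smul, Matrix.mul_one, hK, ← Matrix.mul_assoc, Matrix.mul_nonsing_inv _ hu,
        Matrix.one_mul, one_smul]
    rw [e, Matrix.det_mul, ← Matrix.eval_charpoly, hs₀.eq_zero, mul_zero]

/-- Two vectors with a vanishing nontrivial linear combination lie on a common line `F u`, `u ≠ 0`
(the spare vector `e ≠ 0` is used when both vanish). [folklore] -/
theorem exists_common_line {m : Type*} {s t : F} (hst : s ≠ 0 ∨ t ≠ 0) {p q : m → F}
    (h : s • p + t • q = 0) {e : m → F} (he : e ≠ 0) :
    ∃ u : m → F, u ≠ 0 ∧ ∃ l₁ l₂ : F, p = l₁ • u ∧ q = l₂ • u := by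
  by_cases hp : p = 0
  · by_cases hq : q = 0
    · exact ⟨e, he, 0, 0, by simp [hp], by simp [hq]⟩
    · exact ⟨q, hq, 0, 1, by simp [hp], by simp⟩
  · refine ⟨p, hp, 1, -(t⁻¹ * s), by simp, ?_⟩
    have ht : t ≠ 0 := by
      rintro rfl
      rw [zero_smul, add_zero] at h
      rcases hst with hs | ht
      · exact hp ((smul_eq_zero.1 h).resolve_left hs)
      · exact ht rfl
    have htq : t • q = -(s • p) := eq_neg_of_add_eq_zero_right h
    calc q = t⁻¹ • (t • q) := by rw [smul_smul, inv_mul_cancel₀ ht, one_smul]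
      _ = -(t⁻¹ * s) • p := by rw [htq, smul_neg, smul_smul, neg_smul]

/-- A nonzero vector of `F³` is the first column of an invertible matrix (complete it by two of
the standard basis vectors). [folklore] -/
theorem exists_isUnit_det_col_zero₃ {w : Fin 3 → F} (hw : w ≠ 0) :
    ∃ V : Matrix (Fin 3) (Fin 3) F, IsUnit V.det ∧ ∀ i, V i 0 = w i := by
  by_cases h0 : w 0 ≠ 0
  · refine ⟨!![w 0, 0, 0; w 1, 1, 0; w 2, 0, 1], ?_, fun i => by fin_cases i <;> rfl⟩
    rw [isUnit_iff_ne_zero]; simp [Matrix.det_fin_three, h0]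
  by_cases h1 : w 1 ≠ 0
  · refine ⟨!![w 0, 1, 0; w 1, 0, 0; w 2, 0, 1], ?_, fun i => by fin_cases i <;> rfl⟩
    rw [isUnit_iff_ne_zero]; simp [Matrix.det_fin_three, h1]
  have h2 : w 2 ≠ 0 := by
    intro h2; apply hw; funext i; fin_cases i <;> simp_all
  refine ⟨!![w 0, 1, 0; w 1, 0, 1; w 2, 0, 0], ?_, fun i => by fin_cases i <;> rfl⟩
  rw [isUnit_iff_ne_zero]; simp [Matrix.det_fin_three, h2]

/-- A nonzero vector of `F²` is the first column of an invertible matrix. [folklore] -/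
theorem exists_isUnit_det_col_zero₂ {w : Fin 2 → F} (hw : w ≠ 0) :
    ∃ V : Matrix (Fin 2) (Fin 2) F, IsUnit V.det ∧ ∀ i, V i 0 = w i := by
  by_cases h0 : w 0 ≠ 0
  · refine ⟨!![w 0, 0; w 1, 1], ?_, fun i => by fin_cases i <;> rfl⟩
    rw [isUnit_iff_ne_zero]; simp [Matrix.det_fin_two, h0]
  have h1 : w 1 ≠ 0 := by
    intro h1; apply hw; funext i; fin_cases i <;> simp_all
  refine ⟨!![w 0, 1; w 1, 0], ?_, fun i => by fin_cases i <;> rfl⟩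
  rw [isUnit_iff_ne_zero]; simp [Matrix.det_fin_two, h1]

/-- The mechanism of one triangularisation step: if `M w = l u` where `w`, `u` are the `i₀`-th
columns of `V` and of an invertible `U`, then the `i₀`-th column of `U⁻¹ M V` is supported on
the entry `i₀`. [folklore] -/
theorem conj_apply_eq_zero {n : Type*} [Fintype n] [DecidableEq n] {M U V : Matrix n n F}
    (hU : IsUnit U.det) {w u : n → F} {i₀ : n} (hV : ∀ i, V i i₀ = w i) (hUc : ∀ i, U i i₀ = u i)
    {l : F} (hM : M *ᵥ w = l • u) {i : n} (hi : i ≠ i₀) : (U⁻¹ * M * V) i i₀ = 0 := by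
  have hw : w = V *ᵥ Pi.single i₀ 1 := by
    rw [Matrix.mulVec_single_one]; funext j; exact (hV j).symm
  have hu : u = U *ᵥ Pi.single i₀ 1 := by
    rw [Matrix.mulVec_single_one]; funext j; exact (hUc j).symm
  have e : (U⁻¹ * M * V) i i₀ = ((U⁻¹ * M * V) *ᵥ Pi.single i₀ 1) i := by
    rw [Matrix.mulVec_single_one]; rfl
  rw [e, ← Matrix.mulVec_mulVec, ← Matrix.mulVec_mulVec, ← hw, hM, Matrix.mulVec_smul, hu,
    Matrix.mulVec_mulVec, Matrix.nonsing_inv_mul _ hU, Matrix.one_mulVec]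
  simp [hi]

/-- **Triangularisation step, `3 × 3`**: invertible `U, V` clearing the first column of both
`U⁻¹ M₁ V` and `U⁻¹ M₂ V` below the diagonal (kernel vector of a singular member of the pencil,
extended to bases). [folklore] -/
theorem exists_conj_col_zero₃ [IsAlgClosed F] (M₁ M₂ : Matrix (Fin 3) (Fin 3) F) :
    ∃ U V : Matrix (Fin 3) (Fin 3) F, IsUnit U.det ∧ IsUnit V.det ∧
      ∀ i, i ≠ 0 → (U⁻¹ * M₁ * V) i 0 = 0 ∧ (U⁻¹ * M₂ * V) i 0 = 0 := by
  obtain ⟨s, t, hst, hdet⟩ := exists_det_smul_add_smul_eq_zero M₁ M₂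
  obtain ⟨w, hw0, hw⟩ := Matrix.exists_mulVec_eq_zero_iff.2 hdet
  have hlin : s • (M₁ *ᵥ w) + t • (M₂ *ᵥ w) = 0 := by
    rw [← Matrix.smul_mulVec, ← Matrix.smul_mulVec, ← Matrix.add_mulVec]; exact hw
  have he : (Pi.single 0 1 : Fin 3 → F) ≠ 0 := by
    intro h; simpa using congrFun h 0
  obtain ⟨u, hu0, l₁, l₂, hl₁, hl₂⟩ := exists_common_line hst hlin he
  obtain ⟨U, hU, hUc⟩ := exists_isUnit_det_col_zero₃ hu0
  obtain ⟨V, hV, hVc⟩ := exists_isUnit_det_col_zero₃ hw0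
  exact ⟨U, V, hU, hV, fun i hi =>
    ⟨conj_apply_eq_zero hU hVc hUc hl₁ hi, conj_apply_eq_zero hU hVc hUc hl₂ hi⟩⟩

/-- **Triangularisation step, `2 × 2`**. [folklore] -/
theorem exists_conj_col_zero₂ [IsAlgClosed F] (M₁ M₂ : Matrix (Fin 2) (Fin 2) F) :
    ∃ U V : Matrix (Fin 2) (Fin 2) F, IsUnit U.det ∧ IsUnit V.det ∧
      (U⁻¹ * M₁ * V) 1 0 = 0 ∧ (U⁻¹ * M₂ * V) 1 0 = 0 := by
  obtain ⟨s, t, hst, hdet⟩ := exists_det_smul_add_smul_eq_zero M₁ M₂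
  obtain ⟨w, hw0, hw⟩ := Matrix.exists_mulVec_eq_zero_iff.2 hdet
  have hlin : s • (M₁ *ᵥ w) + t • (M₂ *ᵥ w) = 0 := by
    rw [← Matrix.smul_mulVec, ← Matrix.smul_mulVec, ← Matrix.add_mulVec]; exact hw
  have he : (Pi.single 0 1 : Fin 2 → F) ≠ 0 := by
    intro h; simpa using congrFun h 0
  obtain ⟨u, hu0, l₁, l₂, hl₁, hl₂⟩ := exists_common_line hst hlin he
  obtain ⟨U, hU, hUc⟩ := exists_isUnit_det_col_zero₂ hu0
  obtain ⟨V, hV, hVc⟩ := exists_isUnit_det_col_zero₂ hw0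
  exact ⟨U, V, hU, hV, conj_apply_eq_zero hU hVc hUc hl₁ one_ne_zero,
    conj_apply_eq_zero hU hVc hUc hl₂ one_ne_zero⟩

/-- **Simultaneous triangularisation of a `3 × 3` pencil by equivalence** over an algebraically
closed field: `M₁ = P T₁ Q`, `M₂ = P T₂ Q` with `T₁, T₂` upper triangular (the first step of the
Weierstraß–Kronecker reduction, BCS Thm. (19.3), iterated once on the `2 × 2` block; `P, Q` are in
fact invertible). [folklore] -/
theorem exists_blockTriangular_factor [IsAlgClosed F] (M₁ M₂ : Matrix (Fin 3) (Fin 3) F) :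
    ∃ P Q T₁ T₂ : Matrix (Fin 3) (Fin 3) F,
      T₁.BlockTriangular id ∧ T₂.BlockTriangular id ∧ M₁ = P * T₁ * Q ∧ M₂ = P * T₂ * Q := by
  -- the block-diagonal lift `1 ⊕ U` of a `2 × 2` matrix
  obtain ⟨L, hL⟩ : ∃ L : Matrix (Fin 2) (Fin 2) F → Matrix (Fin 3) (Fin 3) F,
      L = fun U => !![1, 0, 0; 0, U 0 0, U 0 1; 0, U 1 0, U 1 1] := ⟨_, rfl⟩
  have Lmul : ∀ U U', L U * L U' = L (U * U') := by
    intro U U'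
    ext i j
    fin_cases i <;> fin_cases j <;>
      simp [hL, Matrix.mul_apply, Fin.sum_univ_three, Fin.sum_univ_two]
  have Lone : L 1 = 1 := by
    ext i j
    fin_cases i <;> fin_cases j <;> simp [hL]
  obtain ⟨U, V, hU, hV, hUV⟩ := exists_conj_col_zero₃ M₁ M₂
  obtain ⟨M₁', h₁'⟩ : ∃ M', M' = U⁻¹ * M₁ * V := ⟨_, rfl⟩
  obtain ⟨M₂', h₂'⟩ : ∃ M', M' = U⁻¹ * M₂ * V := ⟨_, rfl⟩
  have z₁ : M₁' 1 0 = 0 ∧ M₁' 2 0 = 0 := by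
    rw [h₁']; exact ⟨(hUV 1 (by decide)).1, (hUV 2 (by decide)).1⟩
  have z₂ : M₂' 1 0 = 0 ∧ M₂' 2 0 = 0 := by
    rw [h₂']; exact ⟨(hUV 1 (by decide)).2, (hUV 2 (by decide)).2⟩
  -- the `2 × 2` blocks
  let N₁ : Matrix (Fin 2) (Fin 2) F := fun i j => M₁' i.succ j.succ
  let N₂ : Matrix (Fin 2) (Fin 2) F := fun i j => M₂' i.succ j.succ
  obtain ⟨U₂, V₂, hU₂, hV₂, hN₁, hN₂⟩ := exists_conj_col_zero₂ N₁ N₂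
  obtain ⟨W, hW⟩ : ∃ W, W = U₂⁻¹ := ⟨_, rfl⟩
  obtain ⟨Z, hZ⟩ : ∃ Z, Z = V₂⁻¹ := ⟨_, rfl⟩
  rw [← hW] at hN₁ hN₂
  have hWU : U₂ * W = 1 := by rw [hW, Matrix.mul_nonsing_inv _ hU₂]
  have hVZ : V₂ * Z = 1 := by rw [hZ, Matrix.mul_nonsing_inv _ hV₂]
  refine ⟨U * L U₂, L Z * V⁻¹, L W * M₁' * L V₂, L W * M₂' * L V₂, ?_, ?_, ?_, ?_⟩
  · simp only [Matrix.mul_apply, Fin.sum_univ_two, N₁, Fin.succ_zero_eq_one, Fin.succ_one_eq_two]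
      at hN₁
    rw [blockTriangular_iff₃]
    refine ⟨?_, ?_, ?_⟩ <;> simp only [Matrix.mul_apply, Fin.sum_univ_three] <;>
      simp [hL, z₁.1, z₁.2]
    linear_combination hN₁
  · simp only [Matrix.mul_apply, Fin.sum_univ_two, N₂, Fin.succ_zero_eq_one, Fin.succ_one_eq_two]
      at hN₂
    rw [blockTriangular_iff₃]
    refine ⟨?_, ?_, ?_⟩ <;> simp only [Matrix.mul_apply, Fin.sum_univ_three] <;>
      simp [hL, z₂.1, z₂.2]
    linear_combination hN₂
  · calc M₁ = U * M₁' * V⁻¹ := by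
          rw [h₁']; simp only [Matrix.mul_assoc]
          rw [Matrix.mul_nonsing_inv _ hV, Matrix.mul_one, ← Matrix.mul_assoc,
            Matrix.mul_nonsing_inv _ hU, Matrix.one_mul]
      _ = U * (L U₂ * L W) * M₁' * (L V₂ * L Z) * V⁻¹ := by
          rw [Lmul, Lmul, hWU, hVZ, Lone, Matrix.mul_one, Matrix.mul_one]
      _ = U * L U₂ * (L W * M₁' * L V₂) * (L Z * V⁻¹) := by
          simp only [Matrix.mul_assoc]
  · calc M₂ = U * M₂' * V⁻¹ := by
          rw [h₂']; simp only [Matrix.mul_assoc]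
          rw [Matrix.mul_nonsing_inv _ hV, Matrix.mul_one, ← Matrix.mul_assoc,
            Matrix.mul_nonsing_inv _ hU, Matrix.one_mul]
      _ = U * (L U₂ * L W) * M₂' * (L V₂ * L Z) * V⁻¹ := by
          rw [Lmul, Lmul, hWU, hVZ, Lone, Matrix.mul_one, Matrix.mul_one]
      _ = U * L U₂ * (L W * M₂' * L V₂) * (L Z * V⁻¹) := by
          simp only [Matrix.mul_assoc]

end MatrixPencil

end Literature.Computability.AlgebraicComplexity

end
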